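import Summits.ABC.IUTFork.Cor312SoundInputChecks
import Summits.ABC.IUTFork.Cor312IdentifiedCopies
import HarnessLib

/-!
# [IUTchIII] Cor. 3.12 — the identified-copies reading does NOT imply GapA-as-filed (ADJUDICATION-SPEC §2 (G4))

Record-only file (D-0012) of the abc-iut cell (wave-5 prover abc-iut-w5-d193; proof-only appendix to
`Cor312SoundInputChecks`, p413764); TAKES NO SIDE. ADJUDICATION-SPEC §2 pre-registers the optional item (G4)
`gapA_of_identified : IdentifiedReading P → GapA P` ("the reading SATISFIES the gap statement while voiding its
content"). For GapA := abc-iut-c312-9's `SoundAtInput P G` AS FILED (soundness at EVERY object `o` of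
`†𝒞^⊩_lgp`, p413249) that implication is REFUTED at the interface level: the two-object toy `toySettingTwo`
satisfies Team R's `Cor312.Setting.IdentifiedReading` (its Θ-pilot Kummer images and its `q`-pilot image are
all everything; the (Ind1)(Ind2)-group fixes everything; everything admits its hull) — and `BridgeHyps` and the
printed `Statement` — while `SoundAtInput` fails for every gluing (`not_soundAtInput_toySettingTwo`: the
finiteness conjunct at the non-pilot input). The identified-copies reading constrains the PILOT regions only;
GapA-as-filed constrains every input. For the Θ-pilot instance of GapA (= `P.Statement` definitionally,
abc-iut-skel XXVc `soundAtThetaPilot_iff_statement`) (G4) IS Team R's landed `IdentifiedReading.statement`.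
Nothing here bears on the intended model. typed ≠ proved; no side taken. [cite: ScholzeStix2018, §2.2 pp. 9–10]
-/

noncomputable section

namespace Summit.ABC.IUTFork.Cor312Vol.SoundInputChecks

open Thm311 Cor312 Cor312.Checks Literature.IUT.LogThetaLattice

/-- The two-object toy satisfies Team R's identified-copies reading: its Θ-pilot Kummer images coincide with its
`q`-pilot image (all are everything), the indeterminacy group fixes that image, and it admits its hull.
[folklore] -/
theorem toySettingTwo_identifiedReading : toySettingTwo.IdentifiedReading where
  kummer := fun _ _ _ => rfl
  indFixes := fun Φ _ j vQ => by
    show Φ j vQ '' Set.univ = Set.univ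
    rw [Set.image_univ]
    exact Set.range_eq_univ.mpr (Φ j vQ).surjective
  hasHull := fun _ _ => Set.univ_nonempty

/-- **(G4) refuted for GapA-as-filed**: the identified-copies reading (with `BridgeHyps` and the printed
`Statement`) does not imply `SoundAtInput` at any gluing. [folklore] -/
theorem identifiedReading_not_imp_soundAtInput :
    ∃ (P : Cor312.Setting (toySituation 0)),
      P.IdentifiedReading ∧ BridgeHyps P ∧ P.Statement ∧ ∀ G : LinkGluing P, ¬ SoundAtInput P G :=
  ⟨toySettingTwo, toySettingTwo_identifiedReading, bridgeHyps_toySettingTwo, toySettingTwo_statement,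
    not_soundAtInput_toySettingTwo⟩

/-- … whereas the reading DOES give the finiteness-guarded shape at the constant gluing in the toy (so (G4) in
guarded form is not excluded by this witness). [folklore] -/
theorem identifiedReading_soundAtFiniteInputs_toySettingTwo :
    toySettingTwo.IdentifiedReading ∧
      ∀ o : toySettingTwo.Ob toySettingTwo.sig.Clgp, negLogThetaAt toySettingTwo o ≠ ⊤ →
        ((negLogQAt toySettingTwo ((trivialGluing toySettingTwo).linkMap o) : ℝ) : WithTop ℝ) ≤
          negLogThetaAt toySettingTwo o :=
  ⟨toySettingTwo_identifiedReading, soundAtFiniteInputs_toySettingTwo⟩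

end Summit.ABC.IUTFork.Cor312Vol.SoundInputChecks

end
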